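import Literature.Probability.RandomPlanarGeometry.LoewnerMapProofs
import HarnessLib

/-!
# The Loewner maps `g_t → g_τ` uniformly on compacts as `t → τ`

For a continuous driving function `W` and a compact set `K` of points (real or not) still
flowing at time `τ` (`τ < T_z` for `z ∈ K`), the Loewner maps converge uniformly on `K`:

  `sup_{z ∈ K} ‖g_t(z) - g_τ(z)‖ → 0`  as `t → τ`, `t ≤ τ`

(`Loewner.exists_forall_norm_map_sub_map_lt`). Proof: each trajectory is uniformly continuous
on `[0, τ]`, and trajectories started nearby stay uniformly close on `[0, τ]`
(`IsSolution.exists_forall_dist_lt`, `LoewnerMapProofs`); a finite subcover of `K` concludes.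
Used in the assembly of [LSW] Lemma 6.3 (crossings found at the hitting time `T` persist for
`t < T` close to `T`). Lawler (2005), Ch. 4 §4.1 (continuity of the flow).
-/

noncomputable section

open Set Filter Metric Topology Function Complex
open scoped NNReal

namespace Literature.Probability.RandomPlanarGeometry

namespace Loewner

variable {W : ℝ≥0 → ℝ}

/-- **Uniform convergence of the Loewner maps on compacts of flowing points**: for `K` compact
with `τ < T_z` on `K` and `ε > 0` there is `δ > 0` such that `‖g_t(z) - g_τ(z)‖ < ε` for all
`z ∈ K` and all `t ≤ τ` with `τ - t < δ`. [cite: Lawler2005, Ch. 4 §4.1] -/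
theorem exists_forall_norm_map_sub_map_lt (hW : Continuous W) {τ : ℝ≥0} {K : Set ℂ}
    (hK : IsCompact K) (hKT : ∀ z ∈ K, (τ : WithTop ℝ≥0) < swallowingTime W z) {ε : ℝ}
    (hε : 0 < ε) :
    ∃ δ > 0, ∀ t : ℝ≥0, t ≤ τ → (τ : ℝ) - t < δ → ∀ z ∈ K, ‖map W t z - map W τ z‖ < ε := by
  classical
  have hε3 : 0 < ε / 3 := by positivity
  -- for each point of `K`: its trajectory, a radius of uniform closeness, a modulus of continuity
  have hdata : ∀ z ∈ K, ∃ ρ > 0, ∃ η > 0, ∀ z' : ℂ, dist z' z < ρ →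
      ∀ t : ℝ≥0, t ≤ τ → (τ : ℝ) - t < η → ‖map W t z' - map W τ z'‖ < ε := by
    intro z hz
    have hzT := hKT z hz
    obtain ⟨g, hg⟩ := exists_isSolution_swallowingTime_holds hW (ne_driving_of_lt_swallowingTime hzT)
    obtain ⟨ρ, hρ, hclose⟩ := hg.exists_forall_dist_lt hW hzT hε3
    -- uniform continuity of `g` on `[0, τ]`
    have hsub : Icc (0 : ℝ) τ ⊆ {s : ℝ | 0 ≤ s ∧ (s.toNNReal : WithTop ℝ≥0) < swallowingTime W z} :=
      fun s hs ↦ ⟨hs.1, lt_of_le_of_lt (WithTop.coe_le_coe.2 (by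
        rw [← Real.toNNReal_coe (r := τ)]; exact Real.toNNReal_le_toNNReal hs.2)) hzT⟩
    have huc : UniformContinuousOn g (Icc (0 : ℝ) τ) :=
      isCompact_Icc.uniformContinuousOn_of_continuous (hg.continuousOn.mono hsub)
    rw [Metric.uniformContinuousOn_iff] at huc
    obtain ⟨η, hη, hmod⟩ := huc (ε / 3) hε3
    refine ⟨ρ, hρ, η, hη, fun z' hz' t htτ hτt ↦ ?_⟩
    obtain ⟨hz'T, hsol⟩ := hclose z' hz'
    obtain ⟨h, hh⟩ := exists_isSolution_swallowingTime_holds hW (ne_driving_of_lt_swallowingTime hz'T)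
    have htT' : (t : WithTop ℝ≥0) < swallowingTime W z' := lt_of_le_of_lt (WithTop.coe_le_coe.2 htτ) hz'T
    have htT : (t : WithTop ℝ≥0) < swallowingTime W z := lt_of_le_of_lt (WithTop.coe_le_coe.2 htτ) hzT
    rw [map_eq_of_isSolution hW hh htT', map_eq_of_isSolution hW hh hz'T]
    have h1 : dist (h t) (g t) < ε / 3 :=
      hsol h _ hh t t.coe_nonneg (NNReal.coe_le_coe.2 htτ) (by rw [Real.toNNReal_coe]; exact htT')
    have h2 : dist (h τ) (g τ) < ε / 3 :=
      hsol h _ hh τ τ.coe_nonneg le_rfl (by rw [Real.toNNReal_coe]; exact hz'T)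
    have h3 : dist (g t) (g τ) < ε / 3 := by
      refine hmod t ⟨t.coe_nonneg, NNReal.coe_le_coe.2 htτ⟩ τ ⟨τ.coe_nonneg, le_rfl⟩ ?_
      rw [dist_comm, Real.dist_eq, abs_of_nonneg (by
        have : (t : ℝ) ≤ τ := NNReal.coe_le_coe.2 htτ
        linarith)]
      exact hτt
    rw [← dist_eq_norm]
    calc dist (h t) (h τ) ≤ dist (h t) (g t) + dist (g t) (g τ) + dist (g τ) (h τ) :=
          dist_triangle4 _ _ _ _
      _ < ε / 3 + ε / 3 + ε / 3 := by rw [dist_comm (g τ)]; gcongr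
      _ = ε := by ring
  choose! ρ hρ η hη hgood using hdata
  -- a finite subcover
  obtain ⟨tf, htf⟩ := hK.elim_finite_subcover (fun z : K ↦ ball (z : ℂ) (ρ z))
    (fun _ ↦ isOpen_ball) (fun z hz ↦ mem_iUnion.2 ⟨⟨z, hz⟩, mem_ball_self (hρ z hz)⟩)
  by_cases hne : tf.Nonempty
  · refine ⟨tf.inf' hne (fun z ↦ η z), (Finset.lt_inf'_iff hne).2 fun z _ ↦ hη z z.2, ?_⟩
    intro t htτ hτt z hz
    obtain ⟨i, hi, hzi⟩ : ∃ i ∈ tf, z ∈ ball ((i : K) : ℂ) (ρ i) := by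
      have := htf hz
      simpa only [mem_iUnion, exists_prop] using this
    refine hgood i i.2 z hzi t htτ (lt_of_lt_of_le hτt ?_)
    exact Finset.inf'_le _ hi
  · -- `K` is empty
    refine ⟨1, one_pos, fun t _ _ z hz ↦ ?_⟩
    exfalso
    rw [Finset.not_nonempty_iff_eq_empty] at hne
    have := htf hz
    rw [hne] at this
    simp at this

end Loewner

end Literature.Probability.RandomPlanarGeometry
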